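import Summits.ValiantsHypothesis.ValiantsHypothesis.Theorems.KPlusLogSqLawTropicalBThreeFourOrderTypeLawWedge
import Summits.ValiantsHypothesis.ValiantsHypothesis.Theorems.KPlusLogSqLawTropicalBThreeFourOrderTypeLawC2
import Summits.ValiantsHypothesis.ValiantsHypothesis.Theorems.KPlusLogSqLawTropicalBThreeFourOrderTypeLawC3
import Summits.ValiantsHypothesis.ValiantsHypothesis.Theorems.KPlusLogSqLawTropicalBThreeFourOrderTypeLawC4
import Summits.ValiantsHypothesis.ValiantsHypothesis.Theorems.KPlusLogSqLawTropicalBThreeFourOrderTypeLawC5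
import Summits.ValiantsHypothesis.ValiantsHypothesis.Theorems.KPlusLogSqLawTropicalBThreeFourOrderTypeLawC6a
import Summits.ValiantsHypothesis.ValiantsHypothesis.Theorems.KPlusLogSqLawTropicalBThreeFourOrderTypeLawC6b
import Summits.ValiantsHypothesis.ValiantsHypothesis.Theorems.KPlusLogSqLawTropicalBClassReversal

/-!
# Route «KPlusLogSqLaw», crux `TropicalB` (stmt-ValiantsHypothesis-19771) — the (3,4) ORDER-TYPE LAWS, MIRROR IMAGES:
# the class-reversal images of the laws C1–C8 and of the wedge law (the second located core family `{3000; 0201, 0030, 1002}`)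

HONEST FRAMING.  Census-structure helper toward the crux `Summit.ValiantsHypothesis.ValiantsHypothesis.Theses.KPlusLogSqLaw.TropicalB` (item
`stmt-ValiantsHypothesis-19771`, route `KPlusLogSqLaw`; cell `pub-symmetroid`, seat val-sym-trop-p5 g12, 2026-08-28; `--supports … --as helper`).
Corollaries of the landed laws (`…ThreeFourOrderTypeLaw*`, `…Wedge`) by the class-reversal duality `ClassReversal.designRowD_of_classRev` (reflect the
exponents `d ↦ D − d ∘ rev` with `D = d₀+d₁+d₂+d₃`): every law `R(d) ⇒ DesignRowD d v ε 18` yields `R(D − d ∘ rev) ⇒ DesignRowD d v ε 18`, and the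
reflected hypotheses are again linear inequalities in `d` (each facet / slope form `g` becomes `l ↦ −g (3 − l)`).  Located motivation (seat memo
ORDER-TYPE-LAWS-g12.md): the exhaustively non-tight `(3,4)` order types found by the seat's scans fall into TWO families — the star of the triple point
`3e₁ = 2e₂ = e₃` (cores `{3000; 0300, 1020, 2001}`, laws C1–C8) and its mirror image, the star of `2e₁ + e₃ = 3e₂ = 2e₃` (cores
`{3000; 0201, 0030, 1002}`, e.g. the cells of `(0,7,11,17)`, `(0,9,13,20)`, `(0,8,9,14)`); this file puts the second family in the kernel without a
second certificate search.  Nothing here bears on `TropicalB` in its window, `WeakLifting`, the doors, `MatrixDescartes` (stmt-18050) or VP ≠ VNP.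
[this cell]
-/

set_option linter.dupNamespace false
set_option autoImplicit false

namespace Summit.ValiantsHypothesis.ValiantsHypothesis.Theorems.KPlusLogSqLaw

namespace ThreeFourCore

open Summit.ValiantsHypothesis.ValiantsHypothesis.Theorems.MatrixDescartes.Negative
open Finset

/-- the reflected exponent vector at `D = d₀ + d₁ + d₂ + d₃` evaluates as `(D − d₃, D − d₂, D − d₁, D − d₀)`. -/
theorem rev_eval (d : Fin 4 → ℕ) :
    (fun l : Fin 4 => d 0 + d 1 + d 2 + d 3 - d (Fin.rev l)) 0 = d 0 + d 1 + d 2 + d 3 - d 3 ∧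
    (fun l : Fin 4 => d 0 + d 1 + d 2 + d 3 - d (Fin.rev l)) 1 = d 0 + d 1 + d 2 + d 3 - d 2 ∧
    (fun l : Fin 4 => d 0 + d 1 + d 2 + d 3 - d (Fin.rev l)) 2 = d 0 + d 1 + d 2 + d 3 - d 1 ∧
    (fun l : Fin 4 => d 0 + d 1 + d 2 + d 3 - d (Fin.rev l)) 3 = d 0 + d 1 + d 2 + d 3 - d 0 := by
  refine ⟨?_, ?_, ?_, ?_⟩ <;> simp only <;> congr 1

/-- every exponent is at most `D = d₀ + d₁ + d₂ + d₃`. -/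
theorem le_total_exp (d : Fin 4 → ℕ) : ∀ l : Fin 4, d l ≤ d 0 + d 1 + d 2 + d 3 := by
  intro l; fin_cases l <;> simp <;> omega

/-- **mirror image of `designRowD_three_four_18`** (class-reversal duality). -/
theorem designRowD_three_four_18_mirror (d : Fin 4 → ℕ) (h1 : d 0 + d 3 ≤ d 1 + d 2) (h2 : 3 * d 2 < d 0 + 2 * d 3) (h3 : 2 * d 1 + d 3 < 3 * d 2)
    (v ε : Fin 3 → Fin 3 → Fin 4 → ℤ) : DesignRowD d v ε 18 := by
  obtain ⟨r0, r1, r2, r3⟩ := rev_eval d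
  refine ClassReversal.designRowD_of_classRev d (d 0 + d 1 + d 2 + d 3) v ε (le_total_exp d) 18
    (designRowD_three_four_18 _ ?_ ?_ ?_ _ _) <;> (have := h1; have := h2; have := h3; simp only [r0, r1, r2, r3]; omega)

/-- **mirror image of `designRowD_three_four_18_C2`** (class-reversal duality). -/
theorem designRowD_three_four_18_C2_mirror (d : Fin 4 → ℕ) (h1 : d 0 + 2 * d 3 ≤ 3 * d 2) (h2 : 2 * d 2 ≤ d 1 + d 3) (h3 : 2 * d 1 ≤ d 0 + d 3) (h4 : 3 * d 2 < 3 * d 3) (h5 : d 0 + 2 * d 3 < 3 * d 2) (h6 : 2 * d 1 < d 0 + d 3)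
    (v ε : Fin 3 → Fin 3 → Fin 4 → ℤ) : DesignRowD d v ε 18 := by
  obtain ⟨r0, r1, r2, r3⟩ := rev_eval d
  refine ClassReversal.designRowD_of_classRev d (d 0 + d 1 + d 2 + d 3) v ε (le_total_exp d) 18
    (designRowD_three_four_18_C2 _ ?_ ?_ ?_ ?_ ?_ ?_ _ _) <;> (have := h1; have := h2; have := h3; have := h4; have := h5; have := h6; simp only [r0, r1, r2, r3]; omega)

/-- **mirror image of `designRowD_three_four_18_C3`** (class-reversal duality). -/
theorem designRowD_three_four_18_C3_mirror (d : Fin 4 → ℕ) (h1 : d 0 + 2 * d 3 ≤ 3 * d 2) (h2 : 3 * d 2 ≤ 2 * d 1 + d 3) (h3 : 3 * d 1 ≤ d 0 + 2 * d 3) (h4 : 2 * d 1 < 2 * d 3) (h5 : 3 * d 2 < 2 * d 1 + d 3) (h6 : d 0 + 2 * d 3 < 3 * d 2)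
    (v ε : Fin 3 → Fin 3 → Fin 4 → ℤ) : DesignRowD d v ε 18 := by
  obtain ⟨r0, r1, r2, r3⟩ := rev_eval d
  refine ClassReversal.designRowD_of_classRev d (d 0 + d 1 + d 2 + d 3) v ε (le_total_exp d) 18
    (designRowD_three_four_18_C3 _ ?_ ?_ ?_ ?_ ?_ ?_ _ _) <;> (have := h1; have := h2; have := h3; have := h4; have := h5; have := h6; simp only [r0, r1, r2, r3]; omega)

/-- **mirror image of `designRowD_three_four_18_C4`** (class-reversal duality). -/
theorem designRowD_three_four_18_C4_mirror (d : Fin 4 → ℕ) (h1 : d 0 + d 3 ≤ 2 * d 1) (h2 : 3 * d 2 ≤ d 0 + 2 * d 3) (h3 : d 1 ≤ d 2) (h4 : 2 * d 1 < 2 * d 3) (h5 : d 0 + d 3 < 2 * d 1) (h6 : 3 * d 2 < d 0 + 2 * d 3)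
    (v ε : Fin 3 → Fin 3 → Fin 4 → ℤ) : DesignRowD d v ε 18 := by
  obtain ⟨r0, r1, r2, r3⟩ := rev_eval d
  refine ClassReversal.designRowD_of_classRev d (d 0 + d 1 + d 2 + d 3) v ε (le_total_exp d) 18
    (designRowD_three_four_18_C4 _ ?_ ?_ ?_ ?_ ?_ ?_ _ _) <;> (have := h1; have := h2; have := h3; have := h4; have := h5; have := h6; simp only [r0, r1, r2, r3]; omega)

/-- **mirror image of `designRowD_three_four_18_C5`** (class-reversal duality). -/
theorem designRowD_three_four_18_C5_mirror (d : Fin 4 → ℕ) (h1 : d 0 + d 3 ≤ d 1 + d 2) (h2 : 3 * d 2 ≤ 2 * d 1 + d 3) (h3 : 2 * d 1 ≤ d 0 + d 3) (h4 : d 0 < d 3) (h5 : 2 * d 1 < d 0 + d 3) (h6 : 3 * d 2 < 2 * d 1 + d 3)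
    (v ε : Fin 3 → Fin 3 → Fin 4 → ℤ) : DesignRowD d v ε 18 := by
  obtain ⟨r0, r1, r2, r3⟩ := rev_eval d
  refine ClassReversal.designRowD_of_classRev d (d 0 + d 1 + d 2 + d 3) v ε (le_total_exp d) 18
    (designRowD_three_four_18_C5 _ ?_ ?_ ?_ ?_ ?_ ?_ _ _) <;> (have := h1; have := h2; have := h3; have := h4; have := h5; have := h6; simp only [r0, r1, r2, r3]; omega)

/-- **mirror image of `designRowD_three_four_18_C6a`** (class-reversal duality). -/
theorem designRowD_three_four_18_C6a_mirror (d : Fin 4 → ℕ) (h1 : 2 * d 1 + d 3 ≤ 3 * d 2) (h2 : d 0 + 3 * d 2 ≤ 4 * d 1) (h3 : 2 * d 1 + d 2 ≤ d 0 + 2 * d 3) (h4 : 3 * d 2 < 3 * d 3) (h5 : 2 * d 1 + d 3 < 3 * d 2) (h6 : d 0 + d 3 < 2 * d 1)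
    (v ε : Fin 3 → Fin 3 → Fin 4 → ℤ) : DesignRowD d v ε 18 := by
  obtain ⟨r0, r1, r2, r3⟩ := rev_eval d
  refine ClassReversal.designRowD_of_classRev d (d 0 + d 1 + d 2 + d 3) v ε (le_total_exp d) 18
    (designRowD_three_four_18_C6a _ ?_ ?_ ?_ ?_ ?_ ?_ _ _) <;> (have := h1; have := h2; have := h3; have := h4; have := h5; have := h6; simp only [r0, r1, r2, r3]; omega)

/-- **mirror image of `designRowD_three_four_18_C6b`** (class-reversal duality). -/
theorem designRowD_three_four_18_C6b_mirror (d : Fin 4 → ℕ) (h1 : d 0 + d 3 ≤ 2 * d 1) (h2 : 2 * d 2 ≤ d 1 + d 3) (h3 : 4 * d 1 ≤ d 0 + 3 * d 2) (h4 : 3 * d 2 < 3 * d 3) (h5 : 2 * d 1 + d 3 < 3 * d 2) (h6 : d 0 + d 3 < 2 * d 1)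
    (v ε : Fin 3 → Fin 3 → Fin 4 → ℤ) : DesignRowD d v ε 18 := by
  obtain ⟨r0, r1, r2, r3⟩ := rev_eval d
  refine ClassReversal.designRowD_of_classRev d (d 0 + d 1 + d 2 + d 3) v ε (le_total_exp d) 18
    (designRowD_three_four_18_C6b _ ?_ ?_ ?_ ?_ ?_ ?_ _ _) <;> (have := h1; have := h2; have := h3; have := h4; have := h5; have := h6; simp only [r0, r1, r2, r3]; omega)

/-- **mirror image of `designRowD_three_four_18_C7`** (class-reversal duality). -/
theorem designRowD_three_four_18_C7_mirror (d : Fin 4 → ℕ) (h1 : d 0 + d 3 ≤ 2 * d 1) (h2 : 2 * d 2 ≤ d 1 + d 3) (h3 : 2 * d 1 + d 3 ≤ 3 * d 2) (h4 : 3 * d 2 < 3 * d 3) (h5 : 2 * d 1 + d 3 < 3 * d 2) (h6 : d 0 + d 3 < 2 * d 1)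
    (v ε : Fin 3 → Fin 3 → Fin 4 → ℤ) : DesignRowD d v ε 18 := by
  obtain ⟨r0, r1, r2, r3⟩ := rev_eval d
  refine ClassReversal.designRowD_of_classRev d (d 0 + d 1 + d 2 + d 3) v ε (le_total_exp d) 18
    (designRowD_three_four_18_C7 _ ?_ ?_ ?_ ?_ ?_ ?_ _ _) <;> (have := h1; have := h2; have := h3; have := h4; have := h5; have := h6; simp only [r0, r1, r2, r3]; omega)

/-- **mirror image of `designRowD_three_four_18_C8`** (class-reversal duality). -/
theorem designRowD_three_four_18_C8_mirror (d : Fin 4 → ℕ) (h1 : d 0 + 2 * d 3 ≤ 3 * d 2) (h2 : 3 * d 2 ≤ 2 * d 1 + d 3) (h3 : d 1 ≤ d 2) (h4 : 2 * d 1 < 2 * d 3) (h5 : 3 * d 2 < 2 * d 1 + d 3) (h6 : d 0 + 2 * d 3 < 3 * d 2)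
    (v ε : Fin 3 → Fin 3 → Fin 4 → ℤ) : DesignRowD d v ε 18 := by
  obtain ⟨r0, r1, r2, r3⟩ := rev_eval d
  refine ClassReversal.designRowD_of_classRev d (d 0 + d 1 + d 2 + d 3) v ε (le_total_exp d) 18
    (designRowD_three_four_18_C8 _ ?_ ?_ ?_ ?_ ?_ ?_ _ _) <;> (have := h1; have := h2; have := h3; have := h4; have := h5; have := h6; simp only [r0, r1, r2, r3]; omega)

/-- **mirror image of `designRowD_three_four_18_wedge`** (class-reversal duality). -/
theorem designRowD_three_four_18_wedge_mirror (d : Fin 4 → ℕ) (h1 : d 2 < d 3) (h2 : d 1 ≤ d 2) (h3 : 2 * d 2 ≤ d 1 + d 3) (h4 : d 0 + 2 * d 3 < 3 * d 2) (h5 : d 0 + d 3 < 2 * d 1)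
    (v ε : Fin 3 → Fin 3 → Fin 4 → ℤ) : DesignRowD d v ε 18 := by
  obtain ⟨r0, r1, r2, r3⟩ := rev_eval d
  refine ClassReversal.designRowD_of_classRev d (d 0 + d 1 + d 2 + d 3) v ε (le_total_exp d) 18
    (designRowD_three_four_18_wedge _ ?_ ?_ ?_ ?_ ?_ _ _) <;> (have := h1; have := h2; have := h3; have := h4; have := h5; simp only [r0, r1, r2, r3]; omega)

end ThreeFourCore

end Summit.ValiantsHypothesis.ValiantsHypothesis.Theorems.KPlusLogSqLaw
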